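import Summits.QuantumFields.YangMills.Theorems.BalabanUVNodesN08AlphaEq324RowSuppliers
import Summits.QuantumFields.YangMills.Theorems.BalabanUVNodesN08AlphaClassIDischarge

/-!
# Route «BalabanUVNodes», Track-A DAG node N08 = [Balaban1985UV3] Thm 1 p. 257 ∕ Thm 2 p. 272 — THE (α) CLAUSE OF THE d = 3 LANE WITH
# THE [B1] (3.24) ROW IN ITS SOURCE-FAITHFUL (OUTPUT-SANDWICH) SHAPE, part 2 of 2: the edited clause `StepAlphaEq324` ∕ `RunAlphaEq324`, implied by
# the lane's `StepAlpha` ∕ `RunAlpha`, and the lane's END THEOREM re-derived from the edited list (part 1 = `…N08AlphaEq324RowSuppliers`: rows C3∕C4)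

Cell `pub-ymgap`, seat `pub-ymgap-dag-n08-w4` gen 0 (WIDTH SEAT 4∕4 on N08 under HUMAN RULING D-0149 ∕ director-ym №197; item = dag-n08-d's LOCATED
«(α)-schema CURRENCY MISMATCH #3» (`HOME/pub-ymgap-dag-n08-d/N08-ALPHA-LOCATED-g7.md` §2, g9), worded to this seat by dag-lead g13 DEDUP-354 (R-W4)).
`bears_on: R4∕N08`; filed `--supports stmt-QuantumFields-20542` (K1⁷).  Two `Prop`-structures + theorems; sorry-free; standard axioms; the lane's
`Summits/QuantumFields/Balaban3D/Proofs/*` files and dag-n08-d's `…N08AlphaClassI(Discharge)` are consumed BY NAME and left untouched.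

THE LOCATED POINT.  In the d = 3 lane's (α) input list (`Balaban3D.Proofs.UVStability3DInputs.StepAlpha`, = gen 0's DATA schema
`…N08AlphaClassI.StepDataRows`) the [Balaban1982Higgs1] (3.24) input sits as TWO rows in the TILTED currency: (a) `h324a` (the small-field volume of the
box, `|log μ(box)| ≤ Ca·rem`) and (c) `h324c` (the cgf-DERIVATIVE bound `sup_{t∈[0,1]} |∂ₜ^{n̄+1} log ∫ e^{t𝒱} d(χμ)| ≤ Cc·(n̄+1)!·rem`), consumed only
through Taylor–Lagrange (`Eq324Chi.eq324_indicator_of_measurableSet`) to produce the printed OUTPUT sandwich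
`B1Sect3Statements.Eq324 ⟨χe^{𝒱}⟩ (⟨𝒱ⁿ⟩ᵀ)ₙ n̄ C (Lᵏε) (3+κ₀) |T₁^{(k)}|` — «⟨χ exp(V)⟩ = exp[⟨V⟩ + … + (1∕n̄!)⟨V^{n̄}⟩ᵀ + O(εᵏ)|T₁|]» ([B1] (3.24)
p. 616).  The row's only printed SOURCE — the lemma of [BenfattoEtAl1978] p. 152 via [B1] p. 616 («we will rely on the results of Benfatto et al. [2]») —
delivers exactly this output sandwich (tree: `B1Eq324BenfattoSpecialisation.abs_log_integral_sub_cumulantSum_le`) and says nothing about tilted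
cumulants; and the lane itself proves the two cuts interchangeable at the leaf (`Balaban3D.Proofs.Cumulant324.cumulant58_of_eq324(_model)`,
`eq324_of_lqb_leaves`; `Run3Cumulant.cumulant58_of_graphRep23'` is already cut at `Eq324`).  This file types the SOURCE-FAITHFUL EDITION of the
list and re-derives the lane's end theorem from it:
* §1–§2 = part 1 (`…N08AlphaEq324RowSuppliers`): `cumulant58∕cumulantLower_series_std_of_eq324` (torus-block carrier) and
  `cumulant58∕cumulantLower_pieces_of_eq324` (the lane's pieces) — rows C3∕C4 from G3D-02 + R-ACT + (25) + ONE `Eq324` row.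
* §3 `StepAlphaEq324 k` (= `StepAlpha k` field for field, except `h324a`∕`h324c` ↦ ONE row
  `h324 : ∀ h U, Eq324 (∫ ω in (𝔖 k).box h, e^{(𝔖 k).𝒱 h U ω} ∂(𝔖 k).μ) ((𝔖 k).cum h U) 𝔠.nbar (𝔠.Ca + 𝔠.Cc) (Lᵏ·g₀²) (3 + 𝔠.κ₀) |T₁^{(k)}|`, i.e. the
  printed sentence at the record's booked (3.24) constant `Ca + Cc` and remainder unit `rem_k = (Lᵏg₀²)^{3+κ₀}|T₁^{(k)}|`), `RunAlphaEq324` (steps + the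
  two B25 displays (67)∘large-field and (68), verbatim).
* §4 `stepAlphaEq324_of_stepAlpha`, `runAlphaEq324_of_runAlpha` (the CURRENT list implies the edited one — the tilted bound is the STRONGER reading; no
  converse is claimed); `bound25_act_eq324`, `bound25_vac_eq324`, `stepResiduals_of_alphaEq324`, `runResiduals_of_alphaEq324` (the lane's reductions
  re-run; only rows C3∕C4 change supplier), ★ `uvStability3D_of_inputsEq324` (= `UVStability3DInputs.uvStability3D_of_inputs` with `RunAlpha ↦
  RunAlphaEq324`: Thm 1 (compact window) ∧ Thm 2 for the CONSTRUCTED run from the source-faithful list) and `not_literal_of_inputsEq324`.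
* §5 `runAlphaEq324_of_data_faces` — dag-n08-d's split «DATA schema ∧ in-edge faces» (`…N08AlphaClassIDischarge.runAlpha_of_data_faces`) lands in
  the edited clause, and `uvStability3D_of_data_facesEq324` is recorded for symmetry (it IS `uvStability3D_of_data_faces`; the point of the edition is
  the weaker DATA row, not a new end statement).
HONEST SCOPE ∕ A6.  Bookkeeping of hypothesis SHAPES: every theorem here with an (α) antecedent is exactly as (non-)vacuous as the lane's theorem it
edits — `RunAlphaEq324` is IMPLIED by `RunAlpha` (§4), so every inhabitant of the lane's clause (e.g. dag-n08-d's zero-data reading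
`…N08AlphaZeroDataRows.runAlpha_zero_iff`, modulo the residual pair) inhabits the edited clause; nothing is decided about the TRUTH of the (3.24) row for
Bałaban's expansion data (that is the cluster expansion = N08's object gap, class II of `HOME/pub-ymgap-dag-n08-b/N08-ALPHA-ROWS.md` §2); not a defect
of any landed module.  Count-neutral; N08 NOT discharged; `B1Eq324BenfattoLemma.BasicLemmaPrinted` untouched (the [2]-line pens'); one finite 𝕋⁴
programme at fixed ε with d = 3 tori of [B10] inside the record, Bałaban AS PRINTED; nothing about d = 4 continuum limits, OS axioms, a mass gap or the
Clay problem — R4 closes the conditional finite-𝕋⁴ rung `BalabanLadder.UV` only.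

References: [Balaban1985UV3] T. Bałaban, Commun. Math. Phys. 102 (1985) 255–275 — (24) p. 262, (58)–(59) p. 270, (37) p. 265, Thm 1 p. 257, Thm 2
p. 272; [Balaban1982Higgs1] T. Bałaban, Commun. Math. Phys. 85 (1982) 603–636 — (3.24) p. 616; [BenfattoEtAl1978] G. Benfatto et al., Commun. Math.
Phys. 59 (1978) 143–166 — Lemma p. 152.
-/

noncomputable section

namespace Summit.QuantumFields.YangMills.Theorems.BalabanUVNodesN08AlphaEq324Row

open MeasureTheory Metric
open scoped BigOperators Nat Matrix.Norms.L2Operator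
open Literature.MathematicalPhysics.QuantumFieldTheory.Balaban1983to89
open Literature.MathematicalPhysics.QuantumFieldTheory.Balaban1983to89.B10
open Literature.MathematicalPhysics.QuantumFieldTheory.Balaban1983to89.B10SectAGathering
open Literature.MathematicalPhysics.QuantumFieldTheory.Balaban1983to89.B10SectCExpansion (Bound44)
open Literature.MathematicalPhysics.QuantumFieldTheory.Balaban1983to89.B10Eq24Cumulant (chiMeasure truncExp)
open Literature.MathematicalPhysics.QuantumFieldTheory.Balaban1983to89.B12TreeDecay (kappa₀ K₀)
open Literature.MathematicalPhysics.QuantumFieldTheory.Balaban1983to89.TreeLengthTorus (tsys tcubeSys)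
open Literature.MathematicalPhysics.QuantumFieldTheory.Balaban1983to89.B1Sect3Statements (Eq324)
open Literature.MathematicalPhysics.QuantumFieldTheory.Balaban1985CMP102
open Literature.MathematicalPhysics.QuantumFieldTheory.Balaban1985CMP102.Setting
open Literature.MathematicalPhysics.QuantumFieldTheory.Balaban1985CMP102.Theorems
open Literature.MathematicalPhysics.QuantumFieldTheory.Balaban1985CMP102.Binders
  (ChartAnalyticityAsCited FarTermsDecayAsCited Norm35StepAsCited LogZTExtensiveAsCited LogZLocalizedAsCited GraphTerms GraphRep23AsCited)
open Literature.MathematicalPhysics.QuantumFieldTheory.Balaban1985CMP102.BindersNewborn (NewbornTerms45AsCited)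
open Summit.QuantumFields.Balaban3D.Carriers
open Summit.QuantumFields.Balaban3D.Proofs
open Summit.QuantumFields.Balaban3D.Proofs.ScalesArithmetic
open Summit.QuantumFields.Balaban3D.Proofs.Constants
open Summit.QuantumFields.Balaban3D.Proofs.UVStability3D
open Summit.QuantumFields.Balaban3D.Proofs.EndTheorem
open Summit.QuantumFields.Balaban3D.Proofs.Inputs
open Summit.QuantumFields.Balaban3D.Proofs.Residuals
open Summit.QuantumFields.Balaban3D.Proofs.Primitives
open Summit.QuantumFields.Balaban3D.Proofs.Family (small28 gk_le_gamma46 gk_le_gammaOO gk_le_gamma71 prov_hb₁ prov_hb₂)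
open Summit.QuantumFields.Balaban3D.Proofs.Representation33 (jet26)
open Summit.QuantumFields.Balaban3D.Proofs.Newborn46 (newborn46_std)
open Summit.QuantumFields.Balaban3D.Proofs.Bound55Std (Fibre49 Fibre57Low hint_std hint47_std)
open Summit.QuantumFields.Balaban3D.Proofs.LiftBridge (liftCfg)
open Summit.QuantumFields.Balaban3D.Proofs.Run3SmallFactors (codeZ)
open Summit.QuantumFields.Balaban3D.Proofs.GroupModelLieC (lieC)
open Summit.QuantumFields.Balaban3D.Proofs.UVStability3DInputs
open Summit.QuantumFields.YangMills.Theorems.BalabanUVNodesN08AlphaClassI (OldTermSizes RunDataRows InEdgeFaces)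
open Summit.QuantumFields.YangMills.Theorems.BalabanUVNodesN08AlphaClassIDischarge (runAlpha_of_data_faces)
open B7Prop1Explicit (hol plaqWord)
open B7Prop1Local (pdevOn loK plaqHiK)
open B7Prop2Explicit (avgIter)

variable {L : ℕ}

open Summit.QuantumFields.YangMills.Theorems.BalabanUVNodesN08AlphaEq324RowSuppliers


/-! ## §3 The (α) inputs with the source-faithful (3.24) row -/

section Alpha

variable {S : Scales L} {G : Type} [GaugeGroup G] [MeasurableSpace G] [HaarData G] (𝔊 : GroupModel G) (𝔠 : AlphaConsts L 𝔊.N)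
  (X : ExternalInputs S G) (𝔖 : ∀ k, StepSeries S G ↥(lieC 𝔊) (nblkOf S 𝔠.lane.carrier k) k) (𝔄 : AlphaData 𝔊 𝔠 X 𝔖)

open Classical in
/-- **THE (α) INPUTS OF STEP `k → k+1`, SOURCE-FAITHFUL (3.24) ROW** — `UVStability3DInputs.StepAlpha k` field for field (GAP binders G3D-01∕02∕04∕05∕06,
displays (26)∕(28)∕(44) + degree floor, identifications `hPY`∕`hPYZ`∕`hact`, data regularity, the external-input property `hU`, the residual pair
R3D-01∕R3D-02), EXCEPT that the two tilted [B1] (3.24) inputs (a) `h324a` (box volume) and (c) `h324c` (cgf-derivative bound) are replaced by ONE row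
`h324` of the printed shape `Eq324`: «⟨χe^{𝒱}⟩ = exp[Σ_{n≤n̄}⟨𝒱ⁿ⟩ᵀ∕n! + r], |r| ≤ (Ca+Cc)·(Lᵏg₀²)^{3+κ₀}|T₁^{(k)}|» for the step's fluctuation
integral over the small-field box, with the data's own cumulants `(𝔖 k).cum` (R-324) and the record's booked (3.24) constant `Ca + Cc`.  HYPOTHESES;
nothing asserted. [cite: Balaban1985UV3, (23)–(33) pp.262–264 + (44) p.267 + (55)–(63) pp.269–272; Balaban1982Higgs1, (3.24) p.616] -/
structure StepAlphaEq324 (k : ℕ) : Prop where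
  /-- the Gaussian measure of (58) is a probability measure -/
  hμ : IsProbabilityMeasure (𝔖 k).μ
  /-- the small-field box is measurable -/
  hboxm : ∀ h, MeasurableSet ((𝔖 k).box h)
  /-- … of positive measure -/
  hbox : ∀ h, (𝔖 k).μ ((𝔖 k).box h) ≠ 0
  /-- the effective potential is a.e.-measurable -/
  hVm : ∀ h U, AEMeasurable ((𝔖 k).𝒱 h U) (𝔖 k).μ
  /-- … and bounded on the box -/
  hVB : ∀ h U, ∀ ω ∈ (𝔖 k).box h, |(𝔖 k).𝒱 h U ω| ≤ 𝔄.Bv k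
  /-- G3D-01 at the (25)-rate (R-ACT) -/
  chart : ∀ Y, ChartAnalyticityAsCited ((𝔖 k).Ψ Y) 𝔠.ρ
    (𝔠.C25 * S.gk k * Real.exp (-(𝔠.κ * (tsys 3 (nblkOf S 𝔠.lane.carrier k)).dj Y)))
  /-- (28) p. 263 -/
  bound28 : ∀ Y h U, ‖(𝔖 k).Bcfg Y h U‖ ≤ 𝔠.cB * (rFun 𝔠.r₀ (S.gk k) * S.gk k * pFun 𝔠.b₀ 𝔠.p₀ (S.gk k))
  /-- (26) in the chart space, for the adjoint action -/
  inv26 : ∀ Y (U : G), ∀ b ∈ ball (0 : (𝔖 k).E) 𝔠.ρ, adjAct 𝔊 (P := S.P) k U b ∈ ball (0 : (𝔖 k).E) 𝔠.ρ →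
    (𝔖 k).Ψ Y (adjAct 𝔊 (P := S.P) k U b) = (𝔖 k).Ψ Y b
  /-- G3D-06 -/
  far_le : FarTermsDecayAsCited (𝔖 k).far
    (fun Y => 𝔠.C25 * S.gk k * Real.exp (-(𝔠.κ * (tsys 3 (nblkOf S 𝔠.lane.carrier k)).dj Y)))
    𝔠.Cfar (S.gk k ^ 7 * (rFun 𝔠.r₀ (S.gk k) * pFun 𝔠.b₀ 𝔠.p₀ (S.gk k)) ^ 7)
  /-- identification of `PY` with the retained jet (batch 11 (a)) -/
  hPY : ∀ h U, (𝔖 k).PY h U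
    = ∑ Y ∈ (𝔖 k).loc (ΩblkOf 𝔠.lane.carrier.M₁ (rcolOf S 𝔠.lane.carrier) (nblkOf S 𝔠.lane.carrier k)) (rretOf S 𝔠.lane.carrier k) h,
        ((jet26 ((𝔖 k).Ψ Y) ((𝔖 k).Bcfg Y h U)).re - (𝔖 k).far Y h U)
  /-- identification of `PYZ` with the retained jet of the G3D-07 pieces -/
  hPYZ : ∀ h U, (𝔖 k).PYZ h U
    = ∑ Y ∈ (𝔖 k).loc (ΩblkOf 𝔠.lane.carrier.M₁ (rcolOf S 𝔠.lane.carrier) (nblkOf S 𝔠.lane.carrier k)) (rretOf S 𝔠.lane.carrier k) h,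
        ((jet26 ((𝔄.Λc k).Ψ Y) ((𝔖 k).Bcfg Y h U)).re - (𝔄.Λc k).far Y h U)
  /-- G3D-04 -/
  norm35 : Norm35StepAsCited (pieces 𝔠.lane X 𝔖 k) 𝔠.c35 𝔠.a35 𝔠.cv 𝔠.cJ35
  /-- G3D-05 -/
  logZT : LogZTExtensiveAsCited (pieces 𝔠.lane X 𝔖 k) 𝔠.cT 𝔠.aT 𝔠.cn 𝔠.cJT
  /-- R-ACT: the graph carrier's activities are the chart activities -/
  hact : ∀ h Y U, ((𝔖 k).Gt h).activities.act Y U = (𝔖 k).act h Y U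
  /-- G3D-02 -/
  hG : ∀ h, GraphRep23AsCited ((𝔖 k).Gt h) (fun U => ∑ n ∈ Finset.Icc 1 𝔠.nbar, (𝔖 k).cum h U n / (n.factorial : ℝ))
    (𝔄.C₂₃ k) (𝔄.c₂₃ k) (𝔄.M₂₃ k) (𝔄.δ₀ k)
  /-- **[B1] (3.24) AS PRINTED, for the step's fluctuation integral over the small-field box** (the source-faithful edition of rows (a) + (c)):
  `⟨χe^{𝒱}⟩ = exp[Σ_{n=1}^{n̄} ⟨𝒱ⁿ⟩ᵀ∕n! + r]`, `|r| ≤ (Ca + Cc)·(Lᵏg₀²)^{3+κ₀}·|T₁^{(k)}|` -/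
  h324 : ∀ h (U : GaugeField S.P (k + 1) G),
    Eq324 (∫ ω in (𝔖 k).box h, Real.exp ((𝔖 k).𝒱 h U ω) ∂(𝔖 k).μ) ((𝔖 k).cum h U) 𝔠.nbar (𝔠.Ca + 𝔠.Cc)
      ((L : ℝ) ^ k * S.g0sq) (3 + 𝔠.κ₀) (S.sites k)
  /-- (44) p. 267 on the previous-scale terms of the data (ONE row: consumers B15 and C10) -/
  h44 : ∀ (h : Hist S.P (k + 1)) (U : GaugeField S.P (k + 1) G), ∀ j ∈ Finset.Icc 1 k,
    Bound44 (oldGeom S.P k j) (fun y n c => (𝔖 k).oldVal h U j y n c) 𝔠.κ₁ (𝔠.M₁ : ℝ) (ell S.P k j) (L : ℝ) 𝔠.B₃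
      (S.gk k) (pFun 𝔠.b₀ 𝔠.p₀ (S.gk k)) 𝔠.C44
  /-- the degree floor «n ≥ 2» of (43) for the previous-scale terms -/
  hfloor : ∀ (h : Hist S.P (k + 1)) (U : GaugeField S.P (k + 1) G), ∀ j ∈ Finset.Icc 1 k,
    ∀ (y : Site S.P j) (n : ℕ) (c : Fin n → PBond S.P j), (𝔖 k).oldVal h U j y n c ≠ 0 → 2 ≤ n
  /-- EXTERNAL-input property ([7] Thm 1): the composite minimizer map `U_k(·, h)` is measurable -/
  hU : ∀ h : Hist S.P k, Measurable (X.UkH k h)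
  /-- data regularity: the interaction sum `Pint k h` of (43) (DEFINED from the activities) is measurable in `U` … -/
  hPm : ∀ h : Hist S.P k, Measurable ((inputOf 𝔠.lane X 𝔖).Pint k h)
  /-- … and bounded above -/
  hPb : ∀ (h : Hist S.P k) (U : GaugeField S.P k G), (inputOf 𝔠.lane X 𝔖).Pint k h U ≤ 𝔄.cP k
  /-- RESIDUAL R3D-01 (p4): «The integral (49)» ≤ (55)·(58), per new history -/
  fibre49 : ∀ h' : Hist S.P (k + 1), Fibre49 X 𝔠.lane.carrier 𝔖 (fun _ => True) k (piecesW 𝔠.lane X 𝔖 k) h'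
  /-- RESIDUAL R3D-02 (p4): the lower step bound at the trivial history -/
  fibre57Low : Fibre57Low X 𝔠.lane.carrier 𝔖 (fun _ => True) k (piecesW 𝔠.lane X 𝔖 k)

/-- **THE (α) INPUTS OF ONE LATTICE APPROXIMATION, SOURCE-FAITHFUL (3.24) ROW**: the edited step inputs for every `k < K` and the two B25 displays of
`UVStability3DInputs.RunAlpha` verbatim ((67) ∘ large field, (68) on the lifted minimizers).  HYPOTHESES. [cite: Balaban1985UV3, (67)–(68) p.273 + pp.273–274] -/
structure RunAlphaEq324 : Prop where
  /-- the step inputs (edited list) -/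
  steps : ∀ k, k + 1 ≤ S.K → StepAlphaEq324 𝔊 𝔠 X 𝔖 𝔄 k
  /-- (67) ∘ the large-field characteristic function of the history, on the averaged lifted minimizers -/
  hLF67 : ∀ k, k ≤ S.K → ∀ (h : Hist S.P k), Hist.Admissible 𝔠.lane.carrier.M₁ (rcolOf S 𝔠.lane.carrier) k h →
    ∀ (U : GaugeField S.P k G), ∀ e ∈ Hist.disc h, S.gk e.1 * pFun 𝔠.lane.carrier.b₀ 𝔠.lane.carrier.p₀ (S.gk e.1) ≤
      ‖((hol (avgIter L (liftCfg 𝔊 (X.UkH k h U)) e.1) (codeZ e) (plaqWord e.2.2.1 e.2.2.2) :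
          (Matrix (Fin 𝔊.N) (Fin 𝔊.N) ℂ)ˣ) : Matrix (Fin 𝔊.N) (Fin 𝔊.N) ℂ) - 1‖
  /-- (68) on the lifted minimizers -/
  h68 : ∀ k, k ≤ S.K → ∀ (h : Hist S.P k), Hist.Admissible 𝔠.lane.carrier.M₁ (rcolOf S 𝔠.lane.carrier) k h →
    ∀ (U : GaugeField S.P k G), ∀ e ∈ Hist.disc h,
      pdevOn (loK L e.1 (codeZ e)) (plaqHiK L e.1 (codeZ e) e.2.2.1 e.2.2.2) (liftCfg 𝔊 (X.UkH k h U)) <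
        𝔠.C68 * (S.gk e.1 * pFun 𝔠.lane.carrier.b₀ 𝔠.lane.carrier.p₀ (S.gk e.1)) * (((L : ℝ) ^ e.1)⁻¹) ^ 2

end Alpha

/-! ## §4 The current list implies the edited one; the lane's reductions and END THEOREM from the edited list -/

section Reduce

variable {S : Scales L} {G : Type} [GaugeGroup G] [MeasurableSpace G] [HaarData G] {𝔊 : GroupModel G} {𝔠 : AlphaConsts L 𝔊.N}
  {X : ExternalInputs S G} {𝔖 : ∀ k, StepSeries S G ↥(lieC 𝔊) (nblkOf S 𝔠.lane.carrier k) k} {𝔄 : AlphaData 𝔊 𝔠 X 𝔖}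

/-- **THE CURRENT (α) LIST IMPLIES THE EDITED ONE**, step by step: rows (a) `h324a` + (c) `h324c` give the printed sandwich `h324` with constant
`Ca + 0 + Cc = Ca + Cc` (the lane's `Eq324Chi.eq324_indicator_of_measurableSet` — Taylor–Lagrange for `t ↦ log ∫ e^{t𝒱} d(χμ)`, the re-expansion
input (b) vanishing since the printed cumulants ARE the data's `(𝔖 k).cum`, R-324); every other row is carried over.  No converse: the tilted
cgf-derivative bound is strictly stronger than the output sandwich. [cite: Balaban1982Higgs1, (3.24) p.616; Balaban1985UV3, (58) p.270] -/
theorem stepAlphaEq324_of_stepAlpha {k : ℕ} (A : StepAlpha 𝔊 𝔠 X 𝔖 𝔄 k) : StepAlphaEq324 𝔊 𝔠 X 𝔖 𝔄 k where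
  hμ := A.hμ
  hboxm := A.hboxm
  hbox := A.hbox
  hVm := A.hVm
  hVB := A.hVB
  chart := A.chart
  bound28 := A.bound28
  inv26 := A.inv26
  far_le := A.far_le
  hPY := A.hPY
  hPYZ := A.hPYZ
  norm35 := A.norm35
  logZT := A.logZT
  hact := A.hact
  hG := A.hG
  h324 h U := by
    haveI := A.hμ
    have h := eq324_indicator_of_measurableSet (C₂ := 0) (𝔖 k).μ (A.hboxm h) (A.hbox h) (A.hVm h U) (A.hVB h U)
      𝔠.nbar ((𝔖 k).cum h U) (A.h324a h U) (by simp [StepSeries.cum]) (A.h324c h U)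
    simpa only [add_zero] using h
  h44 := A.h44
  hfloor := A.hfloor
  hU := A.hU
  hPm := A.hPm
  hPb := A.hPb
  fibre49 := A.fibre49
  fibre57Low := A.fibre57Low

/-- **… and run by run.** [cite: Balaban1985UV3, (67)–(68) p.273 (bookkeeping)] -/
theorem runAlphaEq324_of_runAlpha (R : RunAlpha 𝔊 𝔠 X 𝔖 𝔄) : RunAlphaEq324 𝔊 𝔠 X 𝔖 𝔄 where
  steps k hk := stepAlphaEq324_of_stepAlpha (R.steps k hk)
  hLF67 := R.hLF67
  h68 := R.h68

variable (hS : S.ε₀ = eps0Of 𝔠.gamma0 S.g)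
include hS

/-- **(25) FOR THE ACTIVITIES from G3D-01 + (28)** on the family (twin of `UVStability3DInputs.bound25_act` over the edited list).
[cite: Balaban1985UV3, (25) p.262 + (28)–(29) p.263] -/
theorem bound25_act_eq324 (k : ℕ) (hk : k + 1 ≤ S.K) (A : StepAlphaEq324 𝔊 𝔠 X 𝔖 𝔄 k) (h : Hist S.P (k + 1)) :
    Bound25Printed ⟨(tsys 3 (nblkOf S 𝔠.lane.carrier k)).Dom, GaugeField S.P (k + 1) G, (tsys 3 (nblkOf S 𝔠.lane.carrier k)).dj,
      (𝔖 k).act h⟩ (S.gk k) 𝔠.κ 𝔠.C25 :=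
  ChartFromBound25.bound25_real_of_chart (T := towerOf 𝔠.lane X 𝔖) (k := k) (𝔖 k).Ψ A.chart (𝔖 k).Bcfg A.bound28
    (small28 hS k (by omega)) h

omit hS in
/-- **(25) AT THE CHART CENTRE** (the vacuum activities `Re Ψ_X(0)` of (62)) over the edited list (twin of `UVStability3DInputs.bound25_vac`).
[cite: Balaban1985UV3, (25) p.262] -/
theorem bound25_vac_eq324 (k : ℕ) (A : StepAlphaEq324 𝔊 𝔠 X 𝔖 𝔄 k) :
    Bound25Printed ⟨(tsys 3 (nblkOf S 𝔠.lane.carrier k)).Dom, GaugeField S.P (k + 1) G, (tsys 3 (nblkOf S 𝔠.lane.carrier k)).dj,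
      fun Y _ => ((𝔖 k).Ψ Y 0).re⟩ (S.gk k) 𝔠.κ 𝔠.C25 := by
  intro Y _
  have hρ : 0 < 𝔠.ρ := (A.chart Y).1
  exact (Complex.abs_re_le_norm _).trans ((A.chart Y).2.2 0 (mem_closedBall_self (by positivity)))

/-- **THE RESIDUAL STEP LEAVES FROM THE EDITED (α) STEP INPUTS** on the family: as `UVStability3DInputs.stepResiduals_of_alpha`, with rows C3∕C4 now supplied
by `cumulant58_pieces_of_eq324` ∕ `cumulantLower_pieces_of_eq324` from the ONE source-faithful (3.24) row; C5–C8, C10, C1∕C2 unchanged.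
[cite: Balaban1985UV3, (55)–(61) pp.269–271 + p.272] -/
theorem stepResiduals_of_alphaEq324 (k : ℕ) (hk : k + 1 ≤ S.K) (A : StepAlphaEq324 𝔊 𝔠 X 𝔖 𝔄 k) :
    StepResiduals 𝔠.lane X 𝔖 k := by
  haveI : RegularGaugeGroup G := groupModel_regularGaugeGroup 𝔊
  have hC₂ : 0 ≤ 𝔠.Ca + 0 + 𝔠.Cc := by simpa only [add_zero] using 𝔠.Cac_nonneg
  have h324' : ∀ h (U : GaugeField S.P (k + 1) G),
      Eq324 (∫ ω in (𝔖 k).box h, Real.exp ((𝔖 k).𝒱 h U ω) ∂(𝔖 k).μ) ((𝔖 k).cum h U) 𝔠.nbar (𝔠.Ca + 0 + 𝔠.Cc)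
        ((L : ℝ) ^ k * S.g0sq) (3 + 𝔠.κ₀) (S.sites k) := fun h U => by
    simpa only [add_zero] using A.h324 h U
  exact
  { bound55 := AlphaBound55.bound55_pieces 𝔠.lane X 𝔖 k hk
      (hint_std X 𝔠.lane.carrier 𝔖 (fun _ => True) k A.hU A.hPm (𝔄.cP k) A.hPb) A.fibre49
    bound55Lower := AlphaBound55.bound55Lower_pieces 𝔠.lane X 𝔖 k
      (hint47_std X 𝔠.lane.carrier 𝔖 (fun _ => True) k (A.hU _) (A.hPm _) (𝔄.cP k) (A.hPb _)) A.fibre57Low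
    cumulant58 := cumulant58_pieces_of_eq324 𝔠.lane X 𝔖 k hk A.hμ 𝔠.kappa_ge 𝔠.C25_nonneg 𝔠.one_le_r₀ 𝔠.R₁_ge hC₂ rfl rfl
      A.hact h324' A.hG (bound25_act_eq324 hS k hk A)
    cumulantLower := cumulantLower_pieces_of_eq324 𝔠.lane X 𝔖 k hk A.hμ 𝔠.kappa_ge 𝔠.C25_nonneg 𝔠.one_le_r₀ 𝔠.R₁_ge hC₂ rfl
      A.hact h324' A.hG (bound25_act_eq324 hS k hk A)
    repr33_60 := AlphaRepr.repr33_60_pieces 𝔠.lane X 𝔖 k hk 𝔠.chart (by linarith [𝔠.kappa_ge]) 𝔠.C25_nonneg 𝔠.C25_le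
      𝔠.κ₀_lt_half rfl A.chart A.bound28 (small28 hS k (by omega)) (adjAct 𝔊 (P := S.P) k) A.inv26
      (hdet_adjAct 𝔊 k) A.far_le A.hPY
    vacuumWhole := AlphaRepr.vacuumWhole_pieces 𝔠.lane X 𝔖 k hk 𝔠.kappa_ge 𝔠.C25_nonneg 𝔠.one_le_r₀ 𝔠.R₁_ge rfl rfl A.chart
    decomp35_61 := AlphaRepr.decomp35_61_pieces 𝔠.lane X 𝔖 k hk 𝔠.chart rfl 𝔠.kappa_ge 𝔠.C63_nonneg 𝔠.C63_le 𝔠.one_le_r₀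
      𝔠.κ₀_lt_half 𝔠.R₁_ge rfl A.bound28 (small28 hS k (by omega)) (adjAct 𝔊 (P := S.P) k) (hdet_adjAct 𝔊 k)
      (𝔄.Λc k) A.hPYZ
    norm35 := AlphaRepr.norm35_pieces 𝔠.lane X 𝔖 k 𝔠.c35_pos rfl A.norm35
    oldOutside := AlphaCumulant.oldOutside_pieces 𝔠.lane X 𝔖 k hk 𝔠.C44_nonneg 𝔠.B₃_pos.le 𝔠.κ₁_pos rfl A.h44 A.hfloor
      (gk_le_gammaOO hS k (by omega)) }

/-- **THE RESIDUAL LEAVES OF THE RUN FROM THE EDITED (α) INPUTS** on the family (twin of `UVStability3DInputs.runResiduals_of_alpha`).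
[cite: Balaban1985UV3, (46) p.267 + (65) p.273 + pp.273–274] -/
theorem runResiduals_of_alphaEq324 (R : RunAlphaEq324 𝔊 𝔠 X 𝔖 𝔄) : RunResiduals 𝔠.lane X 𝔖 where
  steps k hk := stepResiduals_of_alphaEq324 hS k hk (R.steps k hk)
  bound46 := AlphaLargeField.bound46_tower 𝔠.lane X 𝔖 𝔠.C44_nonneg 𝔠.Cnew_nonneg 𝔠.B₃_pos.le 𝔠.κ₁_pos rfl
    (fun k hk => (R.steps k hk).h44) (fun k hk => (R.steps k hk).hfloor) (fun k hk => gk_le_gamma46 hS k (by omega))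
    (fun k hk => newborn46_std X 𝔠.lane.carrier 𝔖 k (by omega) (by rw [P_m, P_K]; omega) 𝔠.chart (by linarith [𝔠.kappa_ge])
      𝔠.C25_nonneg 𝔠.C63_nonneg 𝔠.b₀_pos.le 𝔠.p₀_pos (lt_of_lt_of_le one_pos 𝔠.one_le_r₀) (R.steps k hk).chart
      (R.steps k hk).bound28 (small28 hS k (by omega)) (R.steps k hk).far_le (R.steps k hk).hPY (𝔄.Λc k) (𝔄.N45 k)
      (R.steps k hk).hPYZ)
  logZT_le k hk := AlphaRepr.logZT_le_pieces 𝔠.lane X 𝔖 k 𝔠.cT_pos rfl (R.steps k hk).logZT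
  PprT_le k hk := AlphaCumulant.pprT_le_pieces 𝔠.lane X 𝔖 k hk (by linarith [𝔠.kappa_ge]) 𝔠.C25_nonneg rfl
    (bound25_vac_eq324 k (R.steps k hk))
  lf := AlphaLargeField.lf_tower 𝔠.lane X 𝔖 𝔊 𝔠.R₁_nonneg (le_trans zero_le_one 𝔠.one_le_r₀)
    (add_nonneg 𝔠.Cz_nonneg 𝔠.Cv_nonneg) 𝔠.C₅_nonneg 𝔠.C₆_nonneg 𝔠.C68_pos
    (fun j hj => gk_le_gamma71 hS j hj.le) R.hLF67 R.h68 𝔠.prov_r₀p₀ (prov_hb₁ 𝔠 𝔊.N_pos) (prov_hb₂ 𝔠 𝔊.N_pos)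

end Reduce

section End

/-- **BAŁABAN CMP 102 (1985), THEOREM 1 (compact-coupling-window reading) ∧ THEOREM 2 FROM THE SOURCE-FAITHFUL (α) LIST** — the lane's
`UVStability3DInputs.uvStability3D_of_inputs` with its hypothesis `RunAlpha` REPLACED by `RunAlphaEq324` (the [B1] (3.24) input read as the printed
output sandwich): for every group as printed, primitive constants, external inputs, expansion data and auxiliary data, IF on the exhibited family
`S.ε₀ = ε₀(S.g)` the edited (α) inputs hold, THEN `Thm1AsPrintedCompact (laneT 𝔠 X 𝔖).toConstruction ∧ Thm2AsPrintedC (laneT 𝔠 X 𝔖).toConstruction` —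
the bounds (5) with one O(1) per compact coupling window and the inequalities (41) ∧ (47), `k ≤ K`, for the densities `ρ_k = T^kρ₀` of the CONSTRUCTED run.
MODULO the displayed inputs exactly as the lane's theorem; nothing of print is discharged here. [cite: Balaban1985UV3, Thm 1 p.257 + Thm 2 p.272 + p.256 L15–18] -/
theorem uvStability3D_of_inputsEq324
    (𝔠 : ∀ (G : Type) [GaugeGroup G] [MeasurableSpace G] [HaarData G] (𝔊 : GroupModel G), AlphaConsts L 𝔊.N)
    (X : ∀ (G : Type) [GaugeGroup G] [MeasurableSpace G] [HaarData G], GroupModel G → ∀ S : Scales L, ExternalInputs S G)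
    (𝔖 : ∀ (G : Type) [GaugeGroup G] [MeasurableSpace G] [HaarData G] (𝔊 : GroupModel G) (S : Scales L) (k : ℕ),
      StepSeries S G ↥(lieC 𝔊) (nblkOf S (𝔠 G 𝔊).lane.carrier k) k)
    (𝔄 : ∀ (G : Type) [GaugeGroup G] [MeasurableSpace G] [HaarData G] (𝔊 : GroupModel G) (S : Scales L),
      AlphaData 𝔊 (𝔠 G 𝔊) (X G 𝔊 S) (𝔖 G 𝔊 S))
    (hα : ∀ (G : Type) [GaugeGroup G] [MeasurableSpace G] [HaarData G] (𝔊 : GroupModel G) (S : Scales L),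
      S.ε₀ = eps0Of (𝔠 G 𝔊).gamma0 S.g → RunAlphaEq324 𝔊 (𝔠 G 𝔊) (X G 𝔊 S) (𝔖 G 𝔊 S) (𝔄 G 𝔊 S)) :
    Thm1AsPrintedCompact (laneT 𝔠 X 𝔖).toConstruction ∧ Thm2AsPrintedC (laneT 𝔠 X 𝔖).toConstruction :=
  uvStability3D_of_residuals (fun G _ _ _ 𝔊 => (𝔠 G 𝔊).lane) (fun G _ _ _ 𝔊 => (𝔠 G 𝔊).gamma0)
    (fun G _ _ _ 𝔊 => (𝔠 G 𝔊).gamma0_pos) (fun _ _ _ _ 𝔊 => lieChart 𝔊) X 𝔖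
    (fun G _ _ _ 𝔊 S hS => runResiduals_of_alphaEq324 hS (hα G 𝔊 S hS))

/-- **THE LITERAL READING OF THEOREM 1 FAILS ON THE SAME CONSTRUCTED FAMILY** under the edited (α) list (twin of `UVStability3DInputs.not_literal_of_inputs`;
G-B10-01: the vacuum-energy term `d(𝔤) log g_k |T₁^{(k)*}|` of (62) is unbounded per site over the family). [cite: Balaban1985UV3, Thm 1 p.257 + (62) p.271] -/
theorem not_literal_of_inputsEq324
    (𝔠 : ∀ (G : Type) [GaugeGroup G] [MeasurableSpace G] [HaarData G] (𝔊 : GroupModel G), AlphaConsts L 𝔊.N)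
    (X : ∀ (G : Type) [GaugeGroup G] [MeasurableSpace G] [HaarData G], GroupModel G → ∀ S : Scales L, ExternalInputs S G)
    (𝔖 : ∀ (G : Type) [GaugeGroup G] [MeasurableSpace G] [HaarData G] (𝔊 : GroupModel G) (S : Scales L) (k : ℕ),
      StepSeries S G ↥(lieC 𝔊) (nblkOf S (𝔠 G 𝔊).lane.carrier k) k)
    (hL : Odd L ∧ 1 < L) (G : Type) [GaugeGroup G] [MeasurableSpace G] [HaarData G] (𝔊 : GroupModel G)
    (hdim : 1 ≤ (𝔠 G 𝔊).dimg) (𝔄 : ∀ S : Scales L, AlphaData 𝔊 (𝔠 G 𝔊) (X G 𝔊 S) (𝔖 G 𝔊 S))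
    (hα : ∀ S : Scales L, S.ε₀ = eps0Of (𝔠 G 𝔊).gamma0 S.g → RunAlphaEq324 𝔊 (𝔠 G 𝔊) (X G 𝔊 S) (𝔖 G 𝔊 S) (𝔄 S)) :
    (Thm1PrintedCompact (runs (laneT 𝔠 X 𝔖).toConstruction G 𝔊 (eps0Of (𝔠 G 𝔊).gamma0))
        ∧ Thm2Printed (runs (laneT 𝔠 X 𝔖).toConstruction G 𝔊 (eps0Of (𝔠 G 𝔊).gamma0)))
      ∧ ¬ Thm1Printed (runs (laneT 𝔠 X 𝔖).toConstruction G 𝔊 (eps0Of (𝔠 G 𝔊).gamma0)) :=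
  not_literal_of_residuals (fun G _ _ _ 𝔊 => (𝔠 G 𝔊).lane) (fun G _ _ _ 𝔊 => (𝔠 G 𝔊).gamma0) (fun _ _ _ _ 𝔊 => lieChart 𝔊)
    X 𝔖 hL G 𝔊 (𝔠 G 𝔊).gamma0_pos hdim (fun S hS => runResiduals_of_alphaEq324 hS (hα S hS))

end End

/-! ## §5 dag-n08-d's split «DATA schema ∧ in-edge faces» lands in the edited clause -/

section DataFaces

variable {S : Scales L} {G : Type} [GaugeGroup G] [MeasurableSpace G] [HaarData G] {𝔊 : GroupModel G} {𝔠 : AlphaConsts L 𝔊.N}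
  {X : ExternalInputs S G} {𝔖 : ∀ k, StepSeries S G ↥(lieC 𝔊) (nblkOf S 𝔠.lane.carrier k) k} {𝔄 : AlphaData 𝔊 𝔠 X 𝔖}
  {𝔏 : OldTermSizes S G}

/-- **THE EDITED (α) CLAUSE FROM «DATA SCHEMA ∧ IN-EDGE FACES»** (gen 0's `…N08AlphaClassIDischarge.runAlpha_of_data_faces` composed with
`runAlphaEq324_of_runAlpha`): the N08 lineage's species split feeds the source-faithful list unchanged. [cite: Balaban1985UV3, (43)–(44) pp.266–267 + (67)–(68) p.273 (bookkeeping)] -/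
theorem runAlphaEq324_of_data_faces (D : RunDataRows 𝔊 𝔠 X 𝔖 𝔄 𝔏) (F : InEdgeFaces 𝔊 𝔠 X 𝔏) : RunAlphaEq324 𝔊 𝔠 X 𝔖 𝔄 :=
  runAlphaEq324_of_runAlpha (runAlpha_of_data_faces D F)

end DataFaces

end Summit.QuantumFields.YangMills.Theorems.BalabanUVNodesN08AlphaEq324Row

end
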